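import Literature.Analysis.FunctionSpaces.ItoProcessesProofs
import Mathlib.Probability.Martingale.Basic
import HarnessLib

/-!
# Integration by parts against a finite-variation process: `N_t H_t - ∫₀ᵗ N_s dH_s` is a martingale

Trunk T-PROBABILITY (Literature/Probability/Process). Theorems only. Let `𝓕` be a (raw) filtration
of `ℝ≥0` on a probability space, `N` a bounded `𝓕`-martingale which is progressively and jointly
measurable, and `H_t = ∫₀ᵗ h_s ds` the time integral of a bounded progressive, jointly measurable
`h`. Then

  `t ↦ N_t H_t - ∫₀ᵗ N_s h_s ds`

is an `𝓕`-martingale (`martingale_mul_timeIntegral_sub`). This is the elementary case of the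
integration-by-parts formula `N_t H_t = ∫₀ᵗ N dH + ∫₀ᵗ H dN` for a martingale and a process of
finite variation (Revuz–Yor (1999), Ch. IV, Prop. (3.1) with `⟨N, H⟩ = 0`), proved here without
any stochastic integration: over `[s, t]` the increment is `(N_t - N_s) H_s + ∫ₛᵗ (N_t - N_r) h_r dr`,
whose integral against an `𝓕_s`-event vanishes by the martingale property of `N` at time `s`, and,
after Fubini, at each time `r ∈ [s, t]` (Karatzas–Shreve (1988), Ch. 5, proof of Prop. 4.6, the
step showing that `∫₀ᵗ (M_t - M_s) b_s ds`-type terms are martingales). It is used to identify the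
quadratic variation of the martingale part of a solution of a martingale problem
(`Literature.Probability.RandomPlanarGeometry.StationaryAngleLocalMartingale`).

## References

* D. Revuz, M. Yor, *Continuous Martingales and Brownian Motion* (3rd ed., 1999), Ch. IV, Prop. (3.1).
* I. Karatzas, S. Shreve, *Brownian Motion and Stochastic Calculus* (1988), Ch. 5 §4.B, Prop. 4.6.
  [KaratzasShreve1988]
-/

noncomputable section

open MeasureTheory ProbabilityTheory Filter Topology Set Function
open scoped NNReal ENNReal

namespace Literature.Probability.Process

open Literature.Analysis.FunctionSpaces

variable {Ω : Type*} {mΩ : MeasurableSpace Ω} {P : Measure Ω} [IsProbabilityMeasure P]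
  {𝓕 : Filtration ℝ≥0 mΩ}

/-! ### Orthogonality of martingale increments to the past -/

/-- **Martingale increments are orthogonal to bounded `𝓕_s`-measurable weights**:
`E[G (N_t - N_s)] = 0`. [folklore] -/
theorem integral_mul_sub_eq_zero_of_martingale {N : ℝ≥0 → Ω → ℝ} (hN : Martingale N 𝓕 P) {s t : ℝ≥0}
    (hst : s ≤ t) {G : Ω → ℝ} (hG : Measurable[𝓕 s] G) {C : ℝ} (hGb : ∀ ω, |G ω| ≤ C) :
    ∫ ω, G ω * (N t ω - N s ω) ∂P = 0 := by
  set ξ : Ω → ℝ := fun ω ↦ N t ω - N s ω with hξdef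
  have hξ : Integrable ξ P := (hN.integrable t).sub (hN.integrable s)
  have hGs : StronglyMeasurable[𝓕 s] G := hG.stronglyMeasurable
  have hGm : AEStronglyMeasurable G P := (hG.mono (𝓕.le s) le_rfl).aestronglyMeasurable
  have hGξ : Integrable (G * ξ) P :=
    Integrable.bdd_mul (c := C) hξ hGm (Eventually.of_forall fun ω ↦
      (show ‖G ω‖ ≤ C by simpa [Real.norm_eq_abs] using hGb ω))
  have h0 : P[ξ | 𝓕 s] =ᵐ[P] 0 := by
    have h1 := hN.2 s t hst
    have h2 : P[ξ | 𝓕 s] =ᵐ[P] P[N t | 𝓕 s] - P[N s | 𝓕 s] := condExp_sub (hN.integrable t) (hN.integrable s) _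
    have h3 : P[N s | 𝓕 s] = N s := condExp_of_stronglyMeasurable (𝓕.le s) (hN.1 s) (hN.integrable s)
    filter_upwards [h1, h2] with ω hω1 hω2
    rw [hω2, Pi.sub_apply, hω1, h3, sub_self, Pi.zero_apply]
  have h1 : ∫ ω, (G * ξ) ω ∂P = ∫ ω, (P[G * ξ | 𝓕 s]) ω ∂P := (integral_condExp (𝓕.le s)).symm
  have h2 := condExp_mul_of_stronglyMeasurable_left (μ := P) hGs hGξ hξ
  have h3 : ∫ ω, (P[G * ξ | 𝓕 s]) ω ∂P = ∫ ω, (0 : ℝ) ∂P := by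
    refine integral_congr_ae ?_
    filter_upwards [h2, h0] with ω hω hω'
    rw [hω, Pi.mul_apply, hω', Pi.zero_apply, mul_zero]
  have h4 : ∫ ω, G ω * (N t ω - N s ω) ∂P = ∫ ω, (G * ξ) ω ∂P := rfl
  rw [h4, h1, h3, integral_zero]

/-! ### The pairing `N H - ∫ N dH` -/

section Pairing

variable {N h : ℝ≥0 → Ω → ℝ} {CN Ch : ℝ}

/-- A bounded jointly measurable process is integrable on every bounded time interval, for each `ω`.
[folklore] -/
theorem intervalIntegrable_of_bounded {g : ℝ≥0 → Ω → ℝ} (hgm : Measurable (uncurry g)) {C : ℝ}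
    (hgb : ∀ t ω, |g t ω| ≤ C) (ω : Ω) (a b : ℝ) :
    IntervalIntegrable (fun r : ℝ ↦ g r.toNNReal ω) volume a b := by
  refine (intervalIntegrable_const (c := C)).mono_fun' ?_ ?_
  · exact (hgm.comp (measurable_real_toNNReal.prodMk measurable_const)).aestronglyMeasurable
  · exact Eventually.of_forall fun r ↦ by simpa [Real.norm_eq_abs] using hgb r.toNNReal ω

/-- The pairing process `Y_t = N_t H_t - ∫₀ᵗ N_s h_s ds`, `H = ∫ h`, is bounded on bounded time
intervals: `|Y_t| ≤ 2 C_N C_h t`. [folklore] -/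
theorem abs_pairing_le (hNb : ∀ t ω, |N t ω| ≤ CN)
    (hhb : ∀ t ω, |h t ω| ≤ Ch) (t : ℝ≥0) (ω : Ω) :
    |N t ω * timeIntegral h t ω - timeIntegral (fun s ω ↦ N s ω * h s ω) t ω| ≤ 2 * (CN * Ch * t) := by
  have hCN : 0 ≤ CN := (abs_nonneg _).trans (hNb 0 ω)
  have hCh : 0 ≤ Ch := (abs_nonneg _).trans (hhb 0 ω)
  have h1 : |timeIntegral h t ω| ≤ Ch * t := by
    unfold timeIntegral
    have := intervalIntegral.norm_integral_le_of_norm_le_const (a := (0 : ℝ)) (b := (t : ℝ))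
      (f := fun r : ℝ ↦ h r.toNNReal ω) (C := Ch) fun r _ ↦ by rw [Real.norm_eq_abs]; exact hhb _ _
    rw [Real.norm_eq_abs, sub_zero, abs_of_nonneg t.coe_nonneg] at this
    exact this
  have h2 : |timeIntegral (fun s ω ↦ N s ω * h s ω) t ω| ≤ CN * Ch * t := by
    unfold timeIntegral
    have := intervalIntegral.norm_integral_le_of_norm_le_const (a := (0 : ℝ)) (b := (t : ℝ))
      (f := fun r : ℝ ↦ N r.toNNReal ω * h r.toNNReal ω) (C := CN * Ch) fun r _ ↦ by
        rw [Real.norm_eq_abs, abs_mul]; exact mul_le_mul (hNb _ _) (hhb _ _) (abs_nonneg _) hCN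
    rw [Real.norm_eq_abs, sub_zero, abs_of_nonneg t.coe_nonneg] at this
    exact this
  calc _ ≤ |N t ω * timeIntegral h t ω| + |timeIntegral (fun s ω ↦ N s ω * h s ω) t ω| := abs_sub _ _
    _ ≤ CN * (Ch * t) + CN * Ch * t := by
        rw [abs_mul]
        exact add_le_add (mul_le_mul (hNb _ _) h1 (abs_nonneg _) hCN) h2
    _ = 2 * (CN * Ch * t) := by ring

/-- **The increment of the pairing over `[s, t]`**:
`Y_t - Y_s = (N_t - N_s) H_s + ∫ₛᵗ (N_t - N_r) h_r dr`. [folklore] -/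
theorem pairing_sub_pairing (hNm : Measurable (uncurry N)) (hNb : ∀ t ω, |N t ω| ≤ CN)
    (hhm : Measurable (uncurry h)) (hhb : ∀ t ω, |h t ω| ≤ Ch) (s t : ℝ≥0) (ω : Ω) :
    (N t ω * timeIntegral h t ω - timeIntegral (fun s ω ↦ N s ω * h s ω) t ω) -
      (N s ω * timeIntegral h s ω - timeIntegral (fun s ω ↦ N s ω * h s ω) s ω) =
      (N t ω - N s ω) * timeIntegral h s ω +
        ∫ r in (s : ℝ)..t, (N t ω - N r.toNNReal ω) * h r.toNNReal ω := by
  have hCN : 0 ≤ CN := (abs_nonneg _).trans (hNb 0 ω)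
  have hih := intervalIntegrable_of_bounded hhm hhb ω
  have hNh : Measurable (uncurry fun s ω ↦ N s ω * h s ω) := hNm.mul hhm
  have hNhb : ∀ t ω, |N t ω * h t ω| ≤ CN * Ch := fun t ω ↦ by
    rw [abs_mul]; exact mul_le_mul (hNb _ _) (hhb _ _) (abs_nonneg _) hCN
  have hiNh := intervalIntegrable_of_bounded hNh hNhb ω
  unfold timeIntegral
  beta_reduce
  have hsplit : ∫ r in (s : ℝ)..t, (N t ω - N r.toNNReal ω) * h r.toNNReal ω =
      N t ω * ((∫ r in (0 : ℝ)..t, h r.toNNReal ω) - ∫ r in (0 : ℝ)..s, h r.toNNReal ω) -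
        ((∫ r in (0 : ℝ)..t, N r.toNNReal ω * h r.toNNReal ω) - ∫ r in (0 : ℝ)..s, N r.toNNReal ω * h r.toNNReal ω) := by
    rw [intervalIntegral.integral_interval_sub_left (hih 0 t) (hih 0 s),
      intervalIntegral.integral_interval_sub_left (hiNh 0 t) (hiNh 0 s),
      ← intervalIntegral.integral_const_mul, ← intervalIntegral.integral_sub ((hih s t).const_mul _) (hiNh s t)]
    refine intervalIntegral.integral_congr fun r _ ↦ ?_
    ring
  rw [hsplit]
  ring

/-- **`N_t H_t - ∫₀ᵗ N_s h_s ds` is a martingale** for a bounded, progressive, jointly measurable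
martingale `N` and `H = ∫ h` with `h` bounded, progressive and jointly measurable (raw filtration
of `ℝ≥0`, probability measure). Revuz–Yor (1999), Ch. IV, Prop. (3.1) (integration by parts, the
case of a finite-variation factor); Karatzas–Shreve (1988), Ch. 5, proof of Prop. 4.6.
[cite: KaratzasShreve1988, Ch. 5 §4.B Prop. 4.6] -/
theorem martingale_mul_timeIntegral_sub (hN : Martingale N 𝓕 P) (hNprog : IsStronglyProgressive 𝓕 N)
    (hNm : Measurable (uncurry N)) (hNb : ∀ t ω, |N t ω| ≤ CN)
    (hh : IsStronglyProgressive 𝓕 h) (hhm : Measurable (uncurry h)) (hhb : ∀ t ω, |h t ω| ≤ Ch) :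
    Martingale (fun t ω ↦ N t ω * timeIntegral h t ω - timeIntegral (fun s ω ↦ N s ω * h s ω) t ω) 𝓕 P := by
  set Y : ℝ≥0 → Ω → ℝ := fun t ω ↦ N t ω * timeIntegral h t ω - timeIntegral (fun s ω ↦ N s ω * h s ω) t ω
    with hYdef
  -- adaptedness (progressive measurability of the time integrals)
  have hHprog : IsStronglyProgressive 𝓕 (timeIntegral h) := isStronglyProgressive_timeIntegral hh
  have hIprog : IsStronglyProgressive 𝓕 (timeIntegral fun s ω ↦ N s ω * h s ω) :=
    isStronglyProgressive_timeIntegral (hNprog.mul hh)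
  have hYad : StronglyAdapted 𝓕 Y := fun t ↦
    ((hNprog.stronglyAdapted t).mul (hHprog.stronglyAdapted t)).sub (hIprog.stronglyAdapted t)
  -- integrability (boundedness)
  have hYm : ∀ t, Measurable (Y t) := fun t ↦ ((hYad t).mono (𝓕.le t)).measurable
  have hYint : ∀ t, Integrable (Y t) P := fun t ↦
    Integrable.mono' (integrable_const (2 * (CN * Ch * t))) (hYm t).aestronglyMeasurable
      (Eventually.of_forall fun ω ↦ by rw [Real.norm_eq_abs]; exact abs_pairing_le hNb hhb t ω)
  refine ⟨hYad, fun s t hst ↦ ?_⟩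
  -- the martingale property through set integrals
  symm
  refine ae_eq_condExp_of_forall_setIntegral_eq (𝓕.le s) (hYint t) (fun A _ _ ↦ (hYint s).integrableOn)
    (fun A hA _ ↦ ?_) (hYad s).aestronglyMeasurable
  -- `∫_A (Y_t - Y_s) = 0`
  have hkey : ∫ ω in A, (Y t ω - Y s ω) ∂P = 0 := by
    have hincr : ∀ ω, Y t ω - Y s ω = (N t ω - N s ω) * timeIntegral h s ω +
        ∫ r in (s : ℝ)..t, (N t ω - N r.toNNReal ω) * h r.toNNReal ω := fun ω ↦
      pairing_sub_pairing hNm hNb hhm hhb s t ω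
    simp_rw [hincr]
    -- the first term: martingale orthogonality with the weight `1_A H_s`
    have hHs : Measurable[𝓕 s] (timeIntegral h s) := (hHprog.stronglyAdapted s).measurable
    have hHsb : ∀ ω, |timeIntegral h s ω| ≤ Ch * s := fun ω ↦ by
      unfold timeIntegral
      have := intervalIntegral.norm_integral_le_of_norm_le_const (a := (0 : ℝ)) (b := (s : ℝ))
        (f := fun r : ℝ ↦ h r.toNNReal ω) (C := Ch) fun r _ ↦ by rw [Real.norm_eq_abs]; exact hhb _ _
      rw [Real.norm_eq_abs, sub_zero, abs_of_nonneg s.coe_nonneg] at this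
      exact this
    have h1 : ∫ ω in A, (N t ω - N s ω) * timeIntegral h s ω ∂P = 0 := by
      rw [← integral_indicator (𝓕.le s A hA)]
      have heq : (A.indicator fun ω ↦ (N t ω - N s ω) * timeIntegral h s ω) =
          fun ω ↦ (A.indicator (timeIntegral h s) ω) * (N t ω - N s ω) := by
        funext ω; by_cases hω : ω ∈ A <;> simp [hω, mul_comm]
      rw [heq]
      refine integral_mul_sub_eq_zero_of_martingale hN hst (hHs.indicator hA) (C := Ch * s) fun ω ↦ ?_
      by_cases hω : ω ∈ A
      · rw [indicator_of_mem hω]; exact hHsb ω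
      · rw [indicator_of_notMem hω, abs_zero]; exact (abs_nonneg _).trans (hHsb ω)
    -- the second term: Fubini and orthogonality at each time `r ∈ [s, t]`
    have hF : ∀ r : ℝ, r ∈ Ioc (s : ℝ) t → ∫ ω in A, (N t ω - N r.toNNReal ω) * h r.toNNReal ω ∂P = 0 := by
      intro r hr
      have hsr : s ≤ r.toNNReal := by
        rw [← NNReal.coe_le_coe, Real.coe_toNNReal _ (s.coe_nonneg.trans hr.1.le)]; exact hr.1.le
      have hrt : r.toNNReal ≤ t := Real.toNNReal_le_iff_le_coe.2 hr.2
      rw [← integral_indicator (𝓕.le s A hA)]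
      have heq : (A.indicator fun ω ↦ (N t ω - N r.toNNReal ω) * h r.toNNReal ω) =
          fun ω ↦ (A.indicator (h r.toNNReal) ω) * (N t ω - N r.toNNReal ω) := by
        funext ω; by_cases hω : ω ∈ A <;> simp [hω, mul_comm]
      rw [heq]
      refine integral_mul_sub_eq_zero_of_martingale hN hrt ((((hh.stronglyAdapted r.toNNReal).measurable)).indicator
        (𝓕.mono hsr A hA)) (C := Ch) fun ω ↦ ?_
      by_cases hω : ω ∈ A
      · rw [indicator_of_mem hω]; exact hhb _ _
      · rw [indicator_of_notMem hω, abs_zero]; exact (abs_nonneg _).trans (hhb 0 ω)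
    have h2 : ∫ ω in A, (∫ r in (s : ℝ)..t, (N t ω - N r.toNNReal ω) * h r.toNNReal ω) ∂P = 0 := by
      have hle : (s : ℝ) ≤ t := NNReal.coe_le_coe.2 hst
      simp_rw [intervalIntegral.integral_of_le hle]
      -- swap the integrals
      have hint : Integrable (uncurry fun (ω : Ω) (r : ℝ) ↦ (N t ω - N r.toNNReal ω) * h r.toNNReal ω)
          ((P.restrict A).prod (volume.restrict (Ioc (s : ℝ) t))) := by
        have hm : Measurable (uncurry fun (ω : Ω) (r : ℝ) ↦ (N t ω - N r.toNNReal ω) * h r.toNNReal ω) :=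
          ((hNm.comp (measurable_const.prodMk measurable_fst)).sub
            (hNm.comp ((measurable_real_toNNReal.comp measurable_snd).prodMk measurable_fst))).mul
            (hhm.comp ((measurable_real_toNNReal.comp measurable_snd).prodMk measurable_fst))
        refine Integrable.mono' (integrable_const ((CN + CN) * Ch)) hm.aestronglyMeasurable
          (Eventually.of_forall fun q ↦ ?_)
        rw [Real.norm_eq_abs]
        simp only [uncurry]
        rw [abs_mul]
        exact mul_le_mul ((abs_sub _ _).trans (add_le_add (hNb _ _) (hNb _ _))) (hhb _ _) (abs_nonneg _)
          (by linarith [(abs_nonneg _).trans (hNb t q.1)])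
      rw [integral_integral_swap hint]
      refine integral_eq_zero_of_ae ?_
      rw [Filter.EventuallyEq, ae_restrict_iff' measurableSet_Ioc]
      exact Eventually.of_forall fun r hr ↦ hF r hr
    have hi1 : Integrable (fun ω ↦ (N t ω - N s ω) * timeIntegral h s ω) (P.restrict A) := by
      refine (Integrable.mono' (integrable_const ((CN + CN) * (Ch * s))) ?_ (Eventually.of_forall fun ω ↦ ?_))
      · exact ((((hN.1 t).mono (𝓕.le t)).measurable.sub ((hN.1 s).mono (𝓕.le s)).measurable).mul
          (hHs.mono (𝓕.le s) le_rfl)).aestronglyMeasurable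
      · rw [Real.norm_eq_abs, abs_mul]
        exact mul_le_mul ((abs_sub _ _).trans (add_le_add (hNb _ _) (hNb _ _))) (hHsb ω) (abs_nonneg _)
          (by linarith [(abs_nonneg _).trans (hNb t ω)])
    have hi2 : Integrable (fun ω ↦ ∫ r in (s : ℝ)..t, (N t ω - N r.toNNReal ω) * h r.toNNReal ω) (P.restrict A) := by
      have heq : (fun ω ↦ ∫ r in (s : ℝ)..t, (N t ω - N r.toNNReal ω) * h r.toNNReal ω) =
          fun ω ↦ (Y t ω - Y s ω) - (N t ω - N s ω) * timeIntegral h s ω := by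
        funext ω; rw [hincr ω]; ring
      rw [heq]
      exact (((hYint t).sub (hYint s)).integrableOn).sub hi1
    rw [integral_add hi1 hi2, h1, h2, add_zero]
  have hsub : ∫ ω in A, (Y t ω - Y s ω) ∂P = ∫ ω in A, Y t ω ∂P - ∫ ω in A, Y s ω ∂P :=
    integral_sub (hYint t).integrableOn (hYint s).integrableOn
  rw [hsub] at hkey
  linarith

end Pairing

end Literature.Probability.Process
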